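import Literature.NumberTheory.EllipticCurves.KrizLi2019.EisensteinHeegnerLog
import Literature.NumberTheory.Transcendental.PadicLogPrincipalUnits
import Mathlib.NumberTheory.DirichletCharacter.Basic
import HarnessLib

/-!
# Herbrand's direction via Stickelberger, part A: the Stickelberger exponents against a Dirichlet character
# sum to `(b − χ(b))·B_{1,χ⁻¹}`, and a multiplier `b` with `b − χ(b)` a `p`-adic unit exists

Crux `stmt-BirchSwinnertonDyer-20372` (`PrintCFram.BottomClassIndexLawFiveLe`), line `eisenstein-resource-bdp-line`
(registry v13/v14). Purpose of the `HerbrandStickelberger*` files: DISCHARGE the only use the line makes of the named fact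
`MazurWiles1984.thm2_*` (Mazur–Wiles 1984 Thm. 2), namely the HERBRAND direction «`‖B_{1,χ⁻¹}‖_p = 1 ⟹ e_χ(ℤ_p ⊗ Cl K) = 0`»
(`classGroupChiComponent_eq_bot_of_norm_bernoulli_eq_one`), from Stickelberger's theorem for `ℚ(μ_f)` — PROVED in the tree,
`Literature/NumberTheory/GaussSums/StickelbergerIdealClassGroupAnnihilation.lean` §6,
`JacobiSumIdeal.prod_mulEquiv_pow_stickelberger_eq_one`: `Π_σ (σ⁻¹C)^{⌊b·c(σ)/f⌋} = 1` — and the tree's PROVED class field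
theory. This file is the CHARACTER-SUM half (pure arithmetic of Dirichlet characters with values in `ℚ_p`):

* `sum_floor_mul_inv_eq` — for `χ ≠ 1` of level `f` and `b` a unit mod `f`:
  `Σ_{u ∈ (ℤ/f)ˣ} ⌊b·ũ/f⌋ · χ⁻¹(u) = (b − χ(b)) · B_{1,χ⁻¹}` (`ũ ∈ [0,f)` the representative; `B_{1,χ⁻¹}` the tree's
  `generalizedBernoulli 1 χ⁻¹ = (1/f) Σ_j χ⁻¹(j) j`). This is Lang's «`(b − σ_b)θ` acts on the `χ`-eigenspace as
  `(b − χ(b))B_{1,χ̄}`» (Ch. 1 §3, proof of Thm. 3.1) and Washington's Thm. 6.13 computation.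
* `eq_one_of_pow_eq_one_of_norm_sub_one_lt_one` — a root of unity `≡ 1 (mod p)` in `ℚ_p`, `p` odd, is `1`
  (via the tree's `p`-adic logarithm `PadicExp.exp_plog`); hence `norm_sub_one_eq_one_of_pow_eq_one`.
* `exists_isUnit_norm_natCast_sub_apply_eq_one` — for `χ` PRIMITIVE of conductor `f`, `p` odd, and «`χ ≠ ω`» in the
  tree's reading (`¬ ∀ a, p ∤ a → ‖χ(a) − a‖ < 1`): some `b ∈ ℕ`, a unit mod `f`, has `‖b − χ(b)‖_p = 1`.
* `exists_isUnit_norm_sum_floor_eq` — the two combined: a unit `b` mod `f` with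
  `‖Σ_u ⌊b·ũ/f⌋ χ⁻¹(u)‖ = ‖B_{1,χ⁻¹}‖`.

No definitions, no named facts, no `sorry`. BSD is not proved by any of this; no summit statement is proved here.
References: [Lang1990] S. Lang, *Cyclotomic Fields I and II*, GTM 121, Ch. 1 §2 Thm. 2.3, §3 Thm. 3.1 and Cor. 3;
[Washington1997] L. Washington, *Introduction to Cyclotomic Fields*, §6.3 (Thm. 6.13, Herbrand), §5.1 (Teichmüller
character); [IrelandRosen1982] Ch. 15 §3.
-/

noncomputable section

open Finset
open Literature.NumberTheory.EllipticCurves Literature.NumberTheory.LFunctions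
open Literature.NumberTheory.Transcendental

set_option linter.dupNamespace false
set_option autoImplicit false

namespace Summit.BirchSwinnertonDyer.BirchSwinnertonDyer.Theorems.PrintCFram.HerbrandStickelberger

variable {p : ℕ} [Fact p.Prime] {f : ℕ} [NeZero f]

/-! ## §1 The Stickelberger exponents against `χ⁻¹`: `Σ_u ⌊b·ũ/f⌋ χ⁻¹(u) = (b − χ(b)) B_{1,χ⁻¹}` -/

omit [Fact p.Prime] in
/-- A sum over the units of `ℤ/f` of a function vanishing off the units is the sum over all of `ℤ/f`. [folklore] -/
theorem sum_units_eq_sum_of_nonunit {M : Type*} [AddCommMonoid M] (F : ZMod f → M)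
    (hF : ∀ j : ZMod f, ¬ IsUnit j → F j = 0) :
    ∑ u : (ZMod f)ˣ, F (u : ZMod f) = ∑ j : ZMod f, F j := by
  classical
  have h1 : ∑ u : (ZMod f)ˣ, F (u : ZMod f) =
      ∑ j ∈ (Finset.univ : Finset (ZMod f)ˣ).image (fun u : (ZMod f)ˣ => (u : ZMod f)), F j := by
    rw [Finset.sum_image fun u _ v _ h => Units.val_injective h]
  rw [h1]
  apply Finset.sum_subset (Finset.subset_univ _)
  intro j _ hj
  apply hF
  rintro ⟨u, rfl⟩
  exact hj (Finset.mem_image.mpr ⟨u, Finset.mem_univ _, rfl⟩)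

omit [NeZero f] in
/-- `(b·u mod f)` as the representative of `b̄·u`: `((b̄ u)~) = (b·ũ) mod f`. [folklore] -/
theorem val_natCast_mul_units (b : ℕ) (u : (ZMod f)ˣ) :
    (((b : ZMod f) * (u : ZMod f)).val : ℕ) = (b * (u : ZMod f).val) % f := by
  rw [ZMod.val_mul, ZMod.val_natCast, Nat.mod_mul_mod]

/-- `⌊b·ũ/f⌋ = (b·ũ − (b·ũ mod f))/f` as an identity in `ℚ_p` (the coefficient `b⟨c/f⟩ − ⟨bc/f⟩` of Lang's
`(b − σ_b)θ(f)`). [cite: Lang1990, Ch. 1 §2 (FAC 2: the coefficients of (b − σ_b)θ(m))] -/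
theorem natCast_div_eq (b : ℕ) (u : (ZMod f)ˣ) :
    ((b * (u : ZMod f).val / f : ℕ) : ℚ_[p]) =
      ((b : ℚ_[p]) * ((u : ZMod f).val : ℚ_[p]) - ((((b : ZMod f) * (u : ZMod f)).val : ℕ) : ℚ_[p])) / f := by
  have hf : (f : ℚ_[p]) ≠ 0 := by exact_mod_cast NeZero.ne f
  rw [eq_div_iff hf, val_natCast_mul_units]
  have h := Nat.div_add_mod (b * (u : ZMod f).val) f
  have h' : ((f * (b * (u : ZMod f).val / f) + b * (u : ZMod f).val % f : ℕ) : ℚ_[p]) =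
      ((b * (u : ZMod f).val : ℕ) : ℚ_[p]) := by exact_mod_cast h
  push_cast at h'
  linear_combination h'

/-- `Σ_{u ∈ (ℤ/f)ˣ} ũ·χ⁻¹(u) = f·B_{1,χ⁻¹}` for `χ ≠ 1` (the printed `B_{1,χ} = (1/f)Σ_{a=1}^{f} χ(a) a`, tree
`KrizLi2019.generalizedBernoulli_one_eq_sum_div`; non-units contribute `0`).
[cite: Washington1997, §4.1 (B_{1,χ} = (1/f) Σ χ(a) a for χ ≠ 1)] [cite: Lang1990, Ch. 1 §2 (B_{1,χ})] -/
theorem sum_val_mul_inv_eq (χ : DirichletCharacter ℚ_[p] f) (hχ : χ ≠ 1) :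
    ∑ u : (ZMod f)ˣ, ((u : ZMod f).val : ℚ_[p]) * χ⁻¹ (u : ZMod f) =
      (f : ℚ_[p]) * generalizedBernoulli 1 χ⁻¹ := by
  have hf : (f : ℚ_[p]) ≠ 0 := by exact_mod_cast NeZero.ne f
  have hχ' : χ⁻¹ ≠ 1 := inv_ne_one.mpr hχ
  rw [KrizLi2019.generalizedBernoulli_one_eq_sum_div χ⁻¹ hχ', mul_div_cancel₀ _ hf]
  rw [sum_units_eq_sum_of_nonunit (fun j : ZMod f => ((j.val : ℕ) : ℚ_[p]) * χ⁻¹ j)]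
  · exact Finset.sum_congr rfl fun j _ => mul_comm _ _
  · intro j hj
    rw [MulChar.map_nonunit _ hj, mul_zero]

/-- Reindexing by the unit `b`: `Σ_u (b u)~ · χ⁻¹(u) = χ(b) · f·B_{1,χ⁻¹}` (substitute `u ↦ b⁻¹u`, `χ⁻¹(b⁻¹) = χ(b)`).
[cite: Lang1990, Ch. 1 §3 (proof of Thm. 3.1)] -/
theorem sum_val_mul_units_mul_inv_eq (χ : DirichletCharacter ℚ_[p] f) (hχ : χ ≠ 1) {b : ℕ}
    (hb : IsUnit (b : ZMod f)) :
    ∑ u : (ZMod f)ˣ, ((((b : ZMod f) * (u : ZMod f)).val : ℕ) : ℚ_[p]) * χ⁻¹ (u : ZMod f) =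
      χ (b : ZMod f) * ((f : ℚ_[p]) * generalizedBernoulli 1 χ⁻¹) := by
  obtain ⟨β, hβ⟩ := hb
  rw [← sum_val_mul_inv_eq χ hχ, Finset.mul_sum]
  refine (Fintype.sum_bijective (fun u : (ZMod f)ˣ => β * u) (Group.mulLeft_bijective β) _ _
    fun u => ?_)
  have hβ0 : χ (β : ZMod f) ≠ 0 := (β.isUnit.map χ).ne_zero
  rw [← hβ, ← Units.val_mul, MulChar.inv_apply_eq_inv' χ (β * u : (ZMod f)ˣ),
    MulChar.inv_apply_eq_inv' χ u, Units.val_mul, map_mul]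
  field_simp

/-- **The Stickelberger exponents against `χ⁻¹`.** For a Dirichlet character `χ ≠ 1` mod `f` with values in `ℚ_p`
and `b ∈ ℕ` a unit mod `f`: `Σ_{u ∈ (ℤ/f)ˣ} ⌊b·ũ/f⌋ · χ⁻¹(u) = (b − χ(b)) · B_{1,χ⁻¹}` — the scalar by which Lang's
`(b − σ_b)θ(f) = Σ_c (b⟨c/f⟩ − ⟨bc/f⟩) σ_c⁻¹` acts on a class `A` with `σ_c A = χ(c)A` («`(b − σ_b)θ` acts as
`(b − χ(b))B_{1,χ̄}` on the `χ`-eigenspace», proof of Lang's Thm. 3.1; Washington Thm. 6.13 / Ireland–Rosen Ch. 15 §3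
at prime level). [cite: Lang1990, Ch. 1 §3 Thm. 3.1 (proof)] [cite: Washington1997, §6.3 (Stickelberger element on eigenspaces)] -/
theorem sum_floor_mul_inv_eq (χ : DirichletCharacter ℚ_[p] f) (hχ : χ ≠ 1) {b : ℕ}
    (hb : IsUnit (b : ZMod f)) :
    ∑ u : (ZMod f)ˣ, ((b * (u : ZMod f).val / f : ℕ) : ℚ_[p]) * χ⁻¹ (u : ZMod f) =
      ((b : ℚ_[p]) - χ (b : ZMod f)) * generalizedBernoulli 1 χ⁻¹ := by
  have hf : (f : ℚ_[p]) ≠ 0 := by exact_mod_cast NeZero.ne f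
  simp_rw [natCast_div_eq, div_mul_eq_mul_div, ← Finset.sum_div, sub_mul, Finset.sum_sub_distrib, mul_assoc,
    ← Finset.mul_sum]
  rw [sum_val_mul_inv_eq χ hχ, sum_val_mul_units_mul_inv_eq χ hχ hb]
  field_simp

/-! ## §2 Roots of unity `≡ 1 (mod p)` in `ℚ_p` are trivial (`p` odd) -/

/-- **A root of unity which is a principal unit of `ℚ_p` is `1`** (`p ≥ 3`): `y^N = 1`, `N ≥ 1`, `‖y − 1‖ < 1`
force `y = 1` (the `p`-adic logarithm: `N·log y = log 1 = 0`, and `exp ∘ log = id` on `‖y − 1‖ ≤ p⁻¹`; tree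
`PadicExp.plog_pow`, `PadicExp.exp_plog`). [cite: Washington1997, §5.1 (Prop. 5.?: μ_{p−1} ⊂ ℤ_p and the principal units contain no other roots of unity, p odd)] -/
theorem eq_one_of_pow_eq_one_of_norm_sub_one_lt_one (hp3 : 3 ≤ p) {y : ℚ_[p]} (hy : ‖y - 1‖ < 1)
    {N : ℕ} (hN : 0 < N) (hyN : y ^ N = 1) : y = 1 := by
  have hp : p.Prime := Fact.out
  have hle : ‖y - 1‖ ≤ (p : ℝ)⁻¹ := by
    rw [← zpow_neg_one, Padic.norm_le_pow_iff_norm_lt_pow_add_one]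
    simpa using hy
  have hy' : ‖1 - y‖ ≤ (p : ℝ)⁻¹ := by rwa [norm_sub_rev]
  have hlt : ‖1 - y‖ < 1 := by rwa [norm_sub_rev]
  have h1 : PadicExp.plog (y ^ N) = (N : ℚ_[p]) * PadicExp.plog y := PadicExp.plog_pow (ℓ := p) hlt N
  rw [hyN, PadicExp.plog_one] at h1
  have hN0 : (N : ℚ_[p]) ≠ 0 := by exact_mod_cast hN.ne'
  have hlog : PadicExp.plog y = 0 := by
    rcases mul_eq_zero.mp h1.symm with h | h
    · exact absurd h hN0
    · exact h
  have h2 := PadicExp.exp_plog hp3 hy'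
  rw [hlog, NormedSpace.exp_zero] at h2
  exact h2.symm

/-- For `p` odd, a root of unity `y ≠ 1` in `ℚ_p` has `‖y − 1‖ = 1`. [cite: Washington1997, §5.1] -/
theorem norm_sub_one_eq_one_of_pow_eq_one (hp2 : p ≠ 2) {y : ℚ_[p]} {N : ℕ} (hN : 0 < N) (hyN : y ^ N = 1)
    (hy1 : y ≠ 1) : ‖y - 1‖ = 1 := by
  have hp : p.Prime := Fact.out
  have hp3 : 3 ≤ p := by
    rcases hp.eq_two_or_odd' with h | h
    · exact absurd h hp2
    · have := hp.two_le; omega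
  have hny : ‖y‖ = 1 := by
    have h2 := congrArg (‖·‖) hyN
    simp only [norm_pow, norm_one] at h2
    exact (pow_eq_one_iff_of_nonneg (norm_nonneg _) hN.ne').mp h2
  have hle : ‖y - 1‖ ≤ 1 := by
    rw [sub_eq_add_neg]
    refine (Padic.nonarchimedean _ _).trans ?_
    rw [hny, norm_neg, norm_one, max_self]
  rcases hle.lt_or_eq with hlt | heq
  · exact absurd (eq_one_of_pow_eq_one_of_norm_sub_one_lt_one hp3 hlt hN hyN) hy1
  · exact heq

/-! ## §3 A multiplier `b` with `b − χ(b)` a `p`-adic unit -/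

omit [NeZero f] in
/-- The value of a `ℚ_p`-valued Dirichlet character at a unit has norm `1` (it is a root of unity).
[cite: Washington1997, §5.1] -/
theorem norm_apply_units (χ : DirichletCharacter ℚ_[p] f) (u : (ZMod f)ˣ) : ‖χ (u : ZMod f)‖ = 1 := by
  haveI : Fintype (ZMod f)ˣ := Fintype.ofFinite _
  have h1 : χ (u : ZMod f) ^ Fintype.card (ZMod f)ˣ = 1 := by
    rw [← map_pow, ← Units.val_pow_eq_pow_val, pow_card_eq_one, Units.val_one, map_one]
  have h2 := congrArg (‖·‖) h1
  simp only [norm_pow, norm_one] at h2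
  exact (pow_eq_one_iff_of_nonneg (norm_nonneg _) Fintype.card_ne_zero).mp h2

omit [NeZero f] in
/-- The value at a unit is a root of unity: `χ(u)^{#(ℤ/f)ˣ} = 1`. [folklore] -/
theorem apply_units_pow_card_eq_one [Fintype (ZMod f)ˣ] (χ : DirichletCharacter ℚ_[p] f) (u : (ZMod f)ˣ) :
    χ (u : ZMod f) ^ Fintype.card (ZMod f)ˣ = 1 := by
  rw [← map_pow, ← Units.val_pow_eq_pow_val, pow_card_eq_one, Units.val_one, map_one]

omit [NeZero f] in
/-- For `p` odd: two DISTINCT values of `χ` at units are incongruent mod `p`, i.e. `χ(u) ≠ χ(u') ⟹ ‖χ(u) − χ(u')‖ = 1`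
(both are roots of unity in `ℚ_p`). [cite: Washington1997, §5.1] -/
theorem norm_apply_sub_apply_eq_one (hp2 : p ≠ 2) (χ : DirichletCharacter ℚ_[p] f) (u u' : (ZMod f)ˣ)
    (hne : χ (u : ZMod f) ≠ χ (u' : ZMod f)) : ‖χ (u : ZMod f) - χ (u' : ZMod f)‖ = 1 := by
  haveI : Fintype (ZMod f)ˣ := Fintype.ofFinite _
  have hu' : χ (u' : ZMod f) ≠ 0 := (u'.isUnit.map χ).ne_zero
  have hq : (χ (u : ZMod f) / χ (u' : ZMod f)) ^ Fintype.card (ZMod f)ˣ = 1 := by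
    rw [div_pow, apply_units_pow_card_eq_one, apply_units_pow_card_eq_one, div_one]
  have hq1 : χ (u : ZMod f) / χ (u' : ZMod f) ≠ 1 := fun h => hne (div_eq_one_iff_eq hu' |>.mp h)
  have h := norm_sub_one_eq_one_of_pow_eq_one hp2 Fintype.card_pos hq hq1
  have h' : χ (u : ZMod f) - χ (u' : ZMod f) = (χ (u : ZMod f) / χ (u' : ZMod f) - 1) * χ (u' : ZMod f) := by
    field_simp
  rw [h', norm_mul, h, norm_apply_units, one_mul]

/-- **A multiplier with `b − χ(b)` a unit.** For `p` odd and `χ` a PRIMITIVE Dirichlet character of conductor `f` with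
values in `ℚ_p` which is not the Teichmüller character in the tree's reading (`¬ ∀ a, p ∤ a → ‖χ(a) − a‖_p < 1`), there is
`b ∈ ℕ`, a unit mod `f`, with `‖b − χ(b)‖_p = 1`. (Cases: the witness `a` is a unit mod `f` — take `b ≡ a`; else
`f ≠ p`, and either `p ∤ f` — take `b = p` — or `p ∣ f`, `f ≠ p`, and primitivity gives a unit `u ≡ 1 (mod p)` with
`χ(u) ≠ 1 = χ(1)`, so `b = ũ` works since `χ(u) ≢ 1 ≡ ũ`.) This is the choice «`b` with `b − χ(b)` prime to `p`»
of the Herbrand argument («Choosing `b` to be a primitive root modulo `l` we see `l ∤ b^j − 1`», Ireland–Rosen).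
[cite: IrelandRosen1982, Ch. 15 §3 (proof of Herbrand's theorem)] [cite: Washington1997, §6.3 (proof of Thm. 6.13)] -/
theorem exists_isUnit_norm_natCast_sub_apply_eq_one (hp2 : p ≠ 2) (χ : DirichletCharacter ℚ_[p] f)
    (hprim : χ.IsPrimitive) (hχω : ¬ ∀ a : ℤ, ¬ ((p : ℤ) ∣ a) → ‖χ (a : ZMod f) - (a : ℚ_[p])‖ < 1) :
    ∃ b : ℕ, IsUnit (b : ZMod f) ∧ ‖(b : ℚ_[p]) - χ (b : ZMod f)‖ = 1 := by
  have hp : p.Prime := Fact.out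
  -- ultrametric bookkeeping in `ℚ_p`
  have ultra : ∀ x y : ℚ_[p], ‖y‖ < ‖x‖ → ‖x - y‖ = ‖x‖ := fun x y hxy => by
    rw [sub_eq_add_neg, Padic.add_eq_max_of_ne (by rw [norm_neg]; exact hxy.ne'), norm_neg,
      max_eq_left hxy.le]
  push Not at hχω
  obtain ⟨a, hpa, ha⟩ := hχω
  by_cases hua : IsUnit (a : ZMod f)
  · -- Case A: the witness `a` is a unit mod `f`; normalise `‖χ(a) − a‖ = 1` and take `b ∈ ℕ`, `b ≡ a (mod p f)`
    have ha1 : ‖χ (a : ZMod f) - (a : ℚ_[p])‖ = 1 := by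
      refine le_antisymm ?_ ha
      obtain ⟨u, hu⟩ := hua
      rw [sub_eq_add_neg]
      refine (Padic.nonarchimedean _ _).trans (max_le ?_ ?_)
      · rw [← hu, norm_apply_units]
      · rw [norm_neg]; exact Padic.norm_int_le_one a
    set m : ℤ := (p : ℤ) * f with hm_def
    have hm : 0 < m := by
      have h1 : (0 : ℤ) < p := by exact_mod_cast hp.pos
      have h2 : (0 : ℤ) < f := by exact_mod_cast Nat.pos_of_ne_zero (NeZero.ne f)
      exact mul_pos h1 h2
    set b : ℕ := (a % m).toNat with hb_def
    have hb : (b : ℤ) = a % m := Int.toNat_of_nonneg (Int.emod_nonneg _ hm.ne')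
    have hdvd : m ∣ (b : ℤ) - a := ⟨-(a / m), by rw [hb]; linarith [Int.mul_ediv_add_emod a m]⟩
    have hbf : (b : ZMod f) = (a : ZMod f) := by
      have h : ((a : ℤ) : ZMod f) = ((b : ℤ) : ZMod f) :=
        (ZMod.intCast_eq_intCast_iff_dvd_sub a b f).mpr ((dvd_mul_left (f : ℤ) p).trans hdvd)
      rw [Int.cast_natCast] at h
      exact h.symm
    have hbp : ‖(b : ℚ_[p]) - (a : ℚ_[p])‖ < 1 := by
      have h : ((b : ℤ) : ℚ_[p]) - (a : ℚ_[p]) = (((b : ℤ) - a : ℤ) : ℚ_[p]) := by push_cast; ring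
      rw [show ((b : ℕ) : ℚ_[p]) = ((b : ℤ) : ℚ_[p]) by push_cast; rfl, h, Padic.norm_intCast_lt_one_iff]
      exact (dvd_mul_right (p : ℤ) f).trans hdvd
    refine ⟨b, hbf ▸ hua, ?_⟩
    have hrw : (b : ℚ_[p]) - χ (b : ZMod f) = -(χ (a : ZMod f) - (a : ℚ_[p])) - (-((b : ℚ_[p]) - a)) := by
      rw [hbf]; ring
    rw [hrw, ultra _ _ (by rw [norm_neg, norm_neg, ha1]; exact hbp), norm_neg, ha1]
  · -- Case B: `a` is NOT a unit mod `f`; then `f ≠ p`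
    have hfp : f ≠ p := by
      intro hfp
      subst hfp
      apply hua
      rw [isUnit_iff_ne_zero, Ne, ZMod.intCast_zmod_eq_zero_iff_dvd]
      exact hpa
    by_cases hpf : p ∣ f
    · -- `p ∣ f ≠ p`: by primitivity `χ` does not factor through level `p`
      have hnf : ¬ χ.FactorsThrough p := by
        intro h
        have h1 : χ.conductor ≤ p :=
          Nat.sInf_le ((DirichletCharacter.mem_conductorSet_iff χ).mpr h)
        rw [hprim] at h1
        exact hfp (le_antisymm h1 (Nat.le_of_dvd (Nat.pos_of_ne_zero (NeZero.ne f)) hpf))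
      rw [DirichletCharacter.factorsThrough_iff_ker_unitsMap hpf] at hnf
      simp only [SetLike.le_def, MonoidHom.mem_ker, not_forall] at hnf
      obtain ⟨u, hu1, huχ⟩ := hnf
      have huχ' : χ (u : ZMod f) ≠ 1 := by
        intro h
        apply huχ
        ext
        rw [MulChar.coe_toUnitHom, h, Units.val_one]
      refine ⟨(u : ZMod f).val, by rw [ZMod.natCast_zmod_val]; exact u.isUnit, ?_⟩
      rw [ZMod.natCast_zmod_val]
      -- `ũ ≡ 1 (mod p)` since `u ↦ 1` in `(ℤ/p)ˣ`
      have hu1' : (((u : ZMod f).val : ℕ) : ZMod p) = 1 := by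
        have h := congrArg (fun x : (ZMod p)ˣ => (x : ZMod p)) hu1
        simp only [ZMod.unitsMap_def, Units.coe_map, MonoidHom.coe_coe, Units.val_one] at h
        rwa [ZMod.castHom_apply, ZMod.cast_eq_val] at h
      have hval : ‖(((u : ZMod f).val : ℕ) : ℚ_[p]) - 1‖ < 1 := by
        have h : (((u : ZMod f).val : ℕ) : ℚ_[p]) - 1 = ((((u : ZMod f).val : ℤ) - 1 : ℤ) : ℚ_[p]) := by
          push_cast; ring
        rw [h, Padic.norm_intCast_lt_one_iff, ← ZMod.intCast_zmod_eq_zero_iff_dvd]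
        push_cast
        rw [hu1', sub_self]
      have hχ1 : ‖χ (u : ZMod f) - 1‖ = 1 := by
        have h := norm_apply_sub_apply_eq_one hp2 χ u 1 (by rwa [Units.val_one, map_one])
        rwa [Units.val_one, map_one] at h
      have hrw : (((u : ZMod f).val : ℕ) : ℚ_[p]) - χ (u : ZMod f) =
          -(χ (u : ZMod f) - 1) - (-((((u : ZMod f).val : ℕ) : ℚ_[p]) - 1)) := by ring
      rw [hrw, ultra _ _ (by rw [norm_neg, norm_neg, hχ1]; exact hval), norm_neg, hχ1]
    · -- `p ∤ f`: take `b = p`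
      refine ⟨p, (ZMod.isUnit_iff_coprime p f).mpr (hp.coprime_iff_not_dvd.mpr hpf), ?_⟩
      obtain ⟨u, hu⟩ := (ZMod.isUnit_iff_coprime p f).mpr (hp.coprime_iff_not_dvd.mpr hpf)
      have h1 : ‖χ (p : ZMod f)‖ = 1 := by rw [← hu, norm_apply_units]
      have h2 : ‖(p : ℚ_[p])‖ < 1 := by
        rw [show (p : ℚ_[p]) = ((p : ℤ) : ℚ_[p]) by push_cast; rfl, Padic.norm_intCast_lt_one_iff]
      rw [show (p : ℚ_[p]) - χ (p : ZMod f) = -(χ (p : ZMod f) - p) by ring, norm_neg,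
        ultra _ _ (by rw [h1]; exact h2), h1]

/-- **Herbrand's scalar is a unit.** For `p` odd and `χ` primitive of conductor `f`, `χ` not the Teichmüller character
(tree reading): some unit `b` mod `f` makes the Stickelberger scalar `Σ_u ⌊b·ũ/f⌋ χ⁻¹(u) = (b − χ(b))B_{1,χ⁻¹}` have the
same `p`-adic norm as `B_{1,χ⁻¹}`; in particular it is a `p`-adic unit when `‖B_{1,χ⁻¹}‖_p = 1` («If `l ∤ B_j`, then
`l ∤ U_j` and so `A = e`»). [cite: IrelandRosen1982, Ch. 15 §3 (proof of Herbrand's theorem)] [cite: Lang1990, Ch. 1 §3 Thm. 3.1, Cor. 3] -/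
theorem exists_isUnit_norm_sum_floor_eq (hp2 : p ≠ 2) (χ : DirichletCharacter ℚ_[p] f) (hχ : χ ≠ 1)
    (hprim : χ.IsPrimitive) (hχω : ¬ ∀ a : ℤ, ¬ ((p : ℤ) ∣ a) → ‖χ (a : ZMod f) - (a : ℚ_[p])‖ < 1) :
    ∃ b : ℕ, IsUnit (b : ZMod f) ∧
      ‖∑ u : (ZMod f)ˣ, ((b * (u : ZMod f).val / f : ℕ) : ℚ_[p]) * χ⁻¹ (u : ZMod f)‖ =
        ‖(generalizedBernoulli 1 χ⁻¹ : ℚ_[p])‖ := by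
  obtain ⟨b, hb, hnorm⟩ := exists_isUnit_norm_natCast_sub_apply_eq_one hp2 χ hprim hχω
  exact ⟨b, hb, by rw [sum_floor_mul_inv_eq χ hχ hb, norm_mul, hnorm, one_mul]⟩

end Summit.BirchSwinnertonDyer.BirchSwinnertonDyer.Theorems.PrintCFram.HerbrandStickelberger

end
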